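import Summits.QuantumAdvantage.AdviceFreeQNC0.OddPrimeStatements
import Summits.QuantumAdvantage.AdviceFreeQNC0.WalkTubeRank
import Summits.QuantumAdvantage.AdviceFreeQNC0.WalkTubeMass
import Summits.QuantumAdvantage.AdviceFreeQNC0.BinomialTailLower
import Literature.Computability.MetaComplexity.LowDegreeComposition
import Literature.Computability.MetaComplexity.RazborovSmolenskyPoly
import Mathlib.FieldTheory.Finite.Basic
import HarnessLib

/-!
# Cell qa-qnc0 (odd primes): the u-TRANSPORT FOR EVERY PRIME — P8 `WalkTransportF p`, and `p = 2`

Planner qa-qnc0-p2 g12, ROUND-12 §B.5 / `Sketch12b.lean` §8 (statements in `OddPrimeStatements.lean` and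
`RingHardOdd.lean`, verbatim).  PROVED here, for every prime `p`:

* **P8 `walkTransportF : WalkTransportF p`** — `WalkHardF p → RingHardOdd p` with the SAME `θ`.  The ring
  strategy `P` (degree `≤ (log₂ N)^c`) is composed with the BACKWARD chart `xOfU u j = ¬(u_j ⊕ u_{j−1})`
  only, a local map of `𝔽_p`-degree `2` per coordinate for EVERY `p`
  (`ind_xOfU_mem_lowDeg_two`, `[¬(A ⊕ B)] = 1 − [A] − [B] + 2[A][B]`; Literature
  `Smolensky.comp_mem_lowDeg_of_coord_mul`); reading the output bit costs a factor `p − 1`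
  (`[P = 1] = 1 − (P − 1)^{p−1}`, Fermat; `ind_eq_one_mem_lowDeg`), the `xor` with the canonical guess
  `t(x)_j = x_j ⊕ x_{j+1}` adds `4`: total degree `2(p−1)D + 4 ≤ (log₂ n)^{2c+1}` for `n ≥ 4^{p+1}`.  The
  win/lose dictionary `WalkTransport.rel_iff_ringWinU` and the injectivity of the chart `xOfU_uVec` are
  statements about Booleans, hence field-independent.  (P7 `ringHardOfOdd` is seat qa-qnc0-prover-2's,
  `RingHardOdd.lean`.)
* `walkHardF_two : WalkHardF 2` (α's tube bound: `walkHardAll_of_tubeMass_of_binomTailLower tubeMass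
  binomTailLower`; `HasDegF 2 = HasDeg` definitionally), `ringHardOdd_two : RingHardOdd 2` (the odd-class
  form of α with the walk game's own `θ`).

The compositions with P7 and the route's bridge (`ringHard_two_of_oddChain`, `WalkHardF p → AdviceFreeQNC0Sep p`)
are `OddPrimeLadder.lean`.

WHAT THIS IS NOT: no claim on `WalkHardF p` for `p ≥ 5` (OPEN, ROUND-12 §B.6 lemma "M2"); `WalkHardF 3` is
FALSE (`OddPrimeWitnesses.lean`), so for `p = 3` this chain is vacuous; separation NOT moved beyond `p = 2`.
-/

noncomputable section

namespace Summit.QuantumAdvantage.AdviceFreeQNC0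

open Classical
open Finset
open Literature.Computability.QuantumComplexity Literature.Computability.QuantumComplexity.RingHLF
open Literature.Computability.MetaComplexity Literature.Computability.MetaComplexity.Smolensky

/-! ### Degree bookkeeping over an arbitrary field -/

section Degree

variable {F : Type*} [Field F] {n : ℕ}

/-- Over any field, each coordinate of `uExt` (`u_i` for `i < n`, the constant `1` beyond) has an
indicator of degree `≤ 1`. -/
theorem ind_uExt_mem_lowDeg (i : ℕ) :
    (fun u : Fin n → Bool => if uExt u i = true then (1 : F) else 0) ∈ lowDeg F n 1 := by
  by_cases hi : i < n
  · have : (fun u : Fin n → Bool => if uExt u i = true then (1 : F) else 0) = mono F {⟨i, hi⟩} := by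
      funext u
      rw [mono_apply]
      simp [uExt, hi]
    rw [this]
    exact mono_mem_lowDeg (by simp)
  · have : (fun u : Fin n → Bool => if uExt u i = true then (1 : F) else 0) = 1 := by
      funext u
      simp [uExt, hi]
    rw [this]
    exact one_mem_lowDeg 1

/-- The indicator of an XOR: `[f ⊕ g] = [f] + [g] − 2[f][g]`, so degrees add. -/
theorem ind_xor_mem_lowDeg {f g : (Fin n → Bool) → Bool} {Df Dg : ℕ}
    (hf : (fun u => if f u = true then (1 : F) else 0) ∈ lowDeg F n Df)
    (hg : (fun u => if g u = true then (1 : F) else 0) ∈ lowDeg F n Dg) :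
    (fun u => if xor (f u) (g u) = true then (1 : F) else 0) ∈ lowDeg F n (Df + Dg) := by
  have key : ∀ a b : Bool, (if xor a b = true then (1 : F) else 0) =
      (if a = true then (1 : F) else 0) + (if b = true then (1 : F) else 0) -
        2 * ((if a = true then (1 : F) else 0) * (if b = true then (1 : F) else 0)) := by
    intro a b
    cases a <;> cases b <;> norm_num
  have heq : (fun u => if xor (f u) (g u) = true then (1 : F) else 0) =
      (fun u => if f u = true then (1 : F) else 0) + (fun u => if g u = true then (1 : F) else 0) -
        (2 : F) • ((fun u => if f u = true then (1 : F) else 0) *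
          (fun u => if g u = true then (1 : F) else 0)) := by
    funext u
    simp only [Pi.add_apply, Pi.sub_apply, Pi.smul_apply, Pi.mul_apply, smul_eq_mul]
    exact key (f u) (g u)
  rw [heq]
  refine Submodule.sub_mem _ (Submodule.add_mem _ (lowDeg_mono (by omega) hf)
    (lowDeg_mono (by omega) hg)) (Submodule.smul_mem _ _ (mul_mem_lowDeg_add hf hg))

/-- The indicator of a negated XOR: `[¬(f ⊕ g)] = 1 − [f ⊕ g]`. -/
theorem ind_not_xor_mem_lowDeg {f g : (Fin n → Bool) → Bool} {Df Dg : ℕ}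
    (hf : (fun u => if f u = true then (1 : F) else 0) ∈ lowDeg F n Df)
    (hg : (fun u => if g u = true then (1 : F) else 0) ∈ lowDeg F n Dg) :
    (fun u => if (!xor (f u) (g u)) = true then (1 : F) else 0) ∈ lowDeg F n (Df + Dg) := by
  have heq : (fun u => if (!xor (f u) (g u)) = true then (1 : F) else 0) =
      1 - fun u => if xor (f u) (g u) = true then (1 : F) else 0 := by
    funext u
    simp only [Pi.sub_apply, Pi.one_apply]
    cases xor (f u) (g u) <;> simp
  rw [heq]
  exact Submodule.sub_mem _ (one_mem_lowDeg _) (ind_xor_mem_lowDeg hf hg)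

/-- **The inverse chart has `F`-degree `≤ 2` per coordinate, for every field `F`**:
`[xOfU u j] = [¬(u_j ⊕ u_{j-1})] = 1 − [u_j] − [u_{j−1}] + 2[u_j][u_{j−1}]`. -/
theorem ind_xOfU_mem_lowDeg_two (j : Fin (n + 1)) :
    (fun u : Fin n → Bool => if xOfU u j = true then (1 : F) else 0) ∈ lowDeg F n 2 := by
  have hg : (fun u : Fin n → Bool =>
      if (if j.val = 0 then false else uExt u (j.val - 1)) = true then (1 : F) else 0) ∈
        lowDeg F n 1 := by
    by_cases hj0 : j.val = 0
    · have : (fun u : Fin n → Bool =>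
          if (if j.val = 0 then false else uExt u (j.val - 1)) = true then (1 : F) else 0) = 0 := by
        funext u
        simp [hj0]
      rw [this]
      exact Submodule.zero_mem _
    · have : (fun u : Fin n → Bool =>
          if (if j.val = 0 then false else uExt u (j.val - 1)) = true then (1 : F) else 0) =
            fun u => if uExt u (j.val - 1) = true then (1 : F) else 0 := by
        funext u
        simp only [hj0, if_false]
      rw [this]
      exact ind_uExt_mem_lowDeg (j.val - 1)
  have h := ind_not_xor_mem_lowDeg (F := F) (ind_uExt_mem_lowDeg (F := F) (n := n) j.val) hg
  exact h

/-- **The canonical guess has `F`-degree `≤ 2` per coordinate**: `[t(x)_j] = [x_j ⊕ x_{j+1}]`. -/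
theorem ind_tGuess_mem_lowDeg_two {m : ℕ} (j : Fin m) :
    (fun x : Fin m → Bool => if tGuess x j = true then (1 : F) else 0) ∈ lowDeg F m 2 := by
  have h := ind_xor_mem_lowDeg (F := F) (bitFn_mem_lowDeg (D := 1) j le_rfl)
    (bitFn_mem_lowDeg (D := 1) (nxt j) le_rfl)
  exact h

end Degree

/-! ### Reading `[P = 1]` over `𝔽_p` (Fermat) -/

section Fermat

variable {p : ℕ} [Fact p.Prime] {n : ℕ}

/-- `[a = 1] = 1 − (a − 1)^{p−1}` in `𝔽_p` (Fermat's little theorem). -/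
theorem ind_eq_one_eq (a : ZMod p) :
    (if a = 1 then (1 : ZMod p) else 0) = 1 - (a - 1) ^ (p - 1) := by
  have hp : 1 < p := (Fact.out : p.Prime).one_lt
  by_cases h : a = 1
  · rw [if_pos h, h, sub_self, zero_pow (by omega), sub_zero]
  · rw [if_neg h, ZMod.pow_card_sub_one_eq_one (sub_ne_zero.mpr h), sub_self]

/-- **Reading the output bit costs a factor `p − 1` in degree**: `P ∈ lowDeg D` implies
`[P = 1] ∈ lowDeg ((p−1)·D)`. -/
theorem ind_eq_one_mem_lowDeg {D : ℕ} {P : CubeFn (ZMod p) n} (hP : P ∈ lowDeg (ZMod p) n D) :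
    (fun x => if P x = 1 then (1 : ZMod p) else 0) ∈ lowDeg (ZMod p) n ((p - 1) * D) := by
  have heq : (fun x => if P x = 1 then (1 : ZMod p) else 0) = 1 - (P - 1) ^ (p - 1) := by
    funext x
    simp only [Pi.sub_apply, Pi.pow_apply, Pi.one_apply]
    exact ind_eq_one_eq (P x)
  rw [heq]
  exact Submodule.sub_mem _ (one_mem_lowDeg _)
    (pow_mem_lowDeg (Submodule.sub_mem _ hP (one_mem_lowDeg D)) (p - 1))

/-- **The transported strategy over `𝔽_p`**: for `P` of degree `≤ D` on the ring,
`u ↦ [P(xOfU u) = 1] ⊕ t(xOfU u)_g` has `𝔽_p`-degree `≤ (p−1)·D·2 + 4`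
(composition with the degree-`2` chart, `Smolensky.comp_mem_lowDeg_of_coord_mul`). -/
theorem hasDegF_transport {D : ℕ} (P : CubeFn (ZMod p) (n + 1))
    (hP : P ∈ lowDeg (ZMod p) (n + 1) D) (g : Fin (n + 1)) :
    HasDegF p (fun u : Fin n → Bool => xor (decide (P (xOfU u) = 1)) (tGuess (xOfU u) g))
      ((p - 1) * D * 2 + 2 * 2) := by
  unfold HasDegF
  have hQ : (fun u : Fin n → Bool => if decide (P (xOfU u) = 1) = true then (1 : ZMod p) else 0) ∈
      lowDeg (ZMod p) n ((p - 1) * D * 2) := by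
    have h := comp_mem_lowDeg_of_coord_mul (F := ZMod p) xOfU ind_xOfU_mem_lowDeg_two
      (ind_eq_one_mem_lowDeg hP)
    refine (congrArg (· ∈ lowDeg (ZMod p) n ((p - 1) * D * 2)) ?_).mpr h
    funext u
    simp only [decide_eq_true_eq]
  have hT : (fun u : Fin n → Bool => if tGuess (xOfU u) g = true then (1 : ZMod p) else 0) ∈
      lowDeg (ZMod p) n (2 * 2) :=
    comp_mem_lowDeg_of_coord_mul (F := ZMod p) xOfU ind_xOfU_mem_lowDeg_two
      (ind_tGuess_mem_lowDeg_two g)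
  exact ind_xor_mem_lowDeg hQ hT

end Fermat

/-! ### P8: the transport for every prime -/

/-- `log₂ (n+1) ≤ log₂ n + 1`. -/
private theorem log_succ_le' (n : ℕ) : Nat.log 2 (n + 1) ≤ Nat.log 2 n + 1 := by
  have h : n + 1 ≤ 2 ^ (Nat.log 2 n + 1) := Nat.lt_pow_succ_log_self (by norm_num) n
  calc Nat.log 2 (n + 1) ≤ Nat.log 2 (2 ^ (Nat.log 2 n + 1)) := Nat.log_mono_right h
    _ = Nat.log 2 n + 1 := Nat.log_pow (by norm_num) _

/-- Degree bookkeeping: for `n ≥ 4^{p+1}` (so `log₂ n ≥ 2p + 2`),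
`(p−1)·(log₂ (n+1))^c·2 + 4 ≤ (log₂ n)^{2c+1}`. -/
private theorem degree_bookkeepingF {p : ℕ} (hp : 2 ≤ p) {n : ℕ} (hn : 4 ^ (p + 1) ≤ n) (c : ℕ) :
    (p - 1) * (Nat.log 2 (n + 1)) ^ c * 2 + 2 * 2 ≤ (Nat.log 2 n) ^ (2 * c + 1) := by
  have h4 : (4 : ℕ) ^ (p + 1) = 2 ^ (2 * p + 2) := by
    rw [show 2 * p + 2 = 2 * (p + 1) by ring, pow_mul]
    norm_num
  have hlog : 2 * p + 2 ≤ Nat.log 2 n :=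
    Nat.le_log_of_pow_le (by norm_num) (by rw [← h4]; exact hn)
  have hL2 : 2 ≤ Nat.log 2 n := by omega
  have h1 : Nat.log 2 (n + 1) ≤ Nat.log 2 n * Nat.log 2 n := by
    have := log_succ_le' n
    nlinarith
  have hc : (Nat.log 2 (n + 1)) ^ c ≤ (Nat.log 2 n) ^ (2 * c) :=
    calc (Nat.log 2 (n + 1)) ^ c ≤ (Nat.log 2 n * Nat.log 2 n) ^ c := Nat.pow_le_pow_left h1 c
      _ = (Nat.log 2 n) ^ (2 * c) := by rw [← pow_two, ← pow_mul]
  have hone : 1 ≤ (Nat.log 2 n) ^ (2 * c) := Nat.one_le_pow _ _ (by omega)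
  have hmul : (p - 1) * (Nat.log 2 (n + 1)) ^ c * 2 ≤ (p - 1) * (Nat.log 2 n) ^ (2 * c) * 2 :=
    Nat.mul_le_mul_right _ (Nat.mul_le_mul_left _ hc)
  calc (p - 1) * (Nat.log 2 (n + 1)) ^ c * 2 + 2 * 2
      ≤ (p - 1) * (Nat.log 2 n) ^ (2 * c) * 2 + 2 * 2 * (Nat.log 2 n) ^ (2 * c) := by
        have : 2 * 2 ≤ 2 * 2 * (Nat.log 2 n) ^ (2 * c) := by nlinarith
        omega
    _ = (2 * (p - 1) + 4) * (Nat.log 2 n) ^ (2 * c) := by ring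
    _ ≤ Nat.log 2 n * (Nat.log 2 n) ^ (2 * c) := Nat.mul_le_mul_right _ (by omega)
    _ = (Nat.log 2 n) ^ (2 * c + 1) := by ring

/-- **P8 `WalkTransportF p`, every prime `p`: `WalkHardF p → RingHardOdd p`** with the SAME `θ`.
Given a ring strategy `P` (degree `≤ (log₂ N)^c`, `N = n + 1`), the walk strategy
`y_g(u) = [P_g(xOfU u) = 1] ⊕ t(xOfU u)_g` has `𝔽_p`-degree `≤ 2(p−1)(log₂ N)^c + 4 ≤ (log₂ n)^{2c+1}`
(`n ≥ 4^{p+1}`) and wins at charge `n + 2` on `u = uVec x` exactly when `P` solves the ring relation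
at the odd-class pattern `x` (`WalkTransport.rel_iff_ringWinU`, a statement about Booleans, hence
field-independent); `uVec` is injective on the odd class (`xOfU_uVec`). -/
theorem walkTransportF (p : ℕ) [Fact p.Prime] : WalkTransportF p := by
  rintro ⟨θ, hθ, hW⟩
  refine ⟨θ, hθ, fun c => ?_⟩
  obtain ⟨n₀, hn₀⟩ := hW (2 * c + 1)
  refine ⟨max (n₀ + 1) (4 ^ (p + 1) + 1), fun N hN P hP => ?_⟩
  obtain ⟨n, rfl⟩ : ∃ n, N = n + 1 := ⟨N - 1, by omega⟩
  have hn₀n : n₀ ≤ n := by have := le_max_left (n₀ + 1) (4 ^ (p + 1) + 1); omega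
  have hn4p : 4 ^ (p + 1) ≤ n := by have := le_max_right (n₀ + 1) (4 ^ (p + 1) + 1); omega
  have hn4 : 4 ≤ n := le_trans (by
    calc (4 : ℕ) = 4 ^ 1 := by norm_num
      _ ≤ 4 ^ (p + 1) := Nat.pow_le_pow_right (by norm_num) (by omega)) hn4p
  simp only [Nat.add_sub_cancel]
  -- the transported walk strategy and its degree
  set z : (Fin (n + 1) → Bool) → (Fin (n + 1) → Bool) := fun x i => decide (P i x = 1) with hz
  set y : Fin (n + 1) → (Fin n → Bool) → Bool :=
    fun g u => xor (z (xOfU u) g) (tGuess (xOfU u) g) with hy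
  have hdeg : ∀ g, HasDegF p (y g) ((Nat.log 2 n) ^ (2 * c + 1)) := by
    intro g
    have h := hasDegF_transport (P g) (hP g) g
    unfold HasDegF at h ⊢
    exact lowDeg_mono (degree_bookkeepingF (Fact.out : p.Prime).two_le hn4p c) h
  have hwin := hn₀ n hn₀n (n + 2) y hdeg
  -- inject the odd class into the walk game's winning inputs
  have hodd : (univ.filter fun x : Fin (n + 1) → Bool => OddZeros x ∧ Rel x (z x)).card ≤
      (univ.filter fun u : Fin n → Bool => ringWinU (n + 2) y u = true).card := by
    refine Finset.card_le_card_of_injOn uVec ?_ ?_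
    · intro x hx
      rw [Finset.mem_coe, mem_filter] at hx
      rw [Finset.mem_coe, mem_filter]
      exact ⟨mem_univ _, (rel_iff_ringWinU (by omega) x hx.2.1 z).1 hx.2.2⟩
    · intro x₁ hx₁ x₂ hx₂ h
      rw [Finset.mem_coe, mem_filter] at hx₁ hx₂
      rw [← xOfU_uVec (by omega) x₁ hx₁.2.1, ← xOfU_uVec (by omega) x₂ hx₂.2.1, h]
  exact le_trans (by exact_mod_cast hodd) hwin

/-! ### The case `p = 2` (α) -/

/-- **`WalkHardF 2` — α's walk hardness, unconditional** (the tube bound: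
`WalkTubeRank.walkHardAll_of_tubeMass_of_binomTailLower` + `tubeMass` + `binomTailLower`;
`HasDegF 2 = HasDeg` definitionally). -/
theorem walkHardF_two : WalkHardF 2 :=
  walkHardAll_of_tubeMass_of_binomTailLower tubeMass binomTailLower

/-- **`RingHardOdd 2`, unconditional** — the odd-class form of α with the walk game's own `θ`
(no factor `(1 + θ)/2`). -/
theorem ringHardOdd_two : RingHardOdd 2 := walkTransportF 2 walkHardF_two

end Summit.QuantumAdvantage.AdviceFreeQNC0

end
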